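import Summits.BirchSwinnertonDyer.BirchSwinnertonDyer.Theorems.PrintCFramBottomClassIndexLawFiveLeCuspSeedSquarefreeDensity
import HarnessLib

set_option autoImplicit false

/-!
# Crux `PrintCFram.BottomClassIndexLawFiveLe` (stmt-BirchSwinnertonDyer-20372), line `eisenstein-resource-bdp-line` (registry v24):
# LEMMA D OF THE CUSP SEED, EULER FACTORS — removing primes from the modulus of `L(𝟙_{⊥M}·μ, s) = ∏_{ℓ ∤ M}(1 − ℓ^{−s})`
# (cell `bsd-print-cfram`, width seat `bsd-line-cfram-p1-w3` g13; THEOREMS ONLY, `--supports` 20372; Mathlib currency;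
# BSD is not proved by any of this)

HONEST FRAMING. Elementary Dirichlet series (no elliptic curve, no BSD). The density constant of the analytic core
(`FamilyMean.tendsto_sub_one_mul_LSeries_squarefree`) is `L(𝟙_{⊥M}·μ, 2)` with `M = 6mn` depending on the averaged index
`n`; the assembly (E) of the cusp constant (crux notes `Lines/eisenstein-resource-bdp-line-w5g5-cusp-seed.md` §4 (ii)/(iii), §5)
wants the `n`-dependence as the finite Euler factor `∏_{ℓ ∣ n, ℓ ∤ 6m} (1 − ℓ^{−2})^{−1}` (this is where
`c_ℓ(v) = [v even]·ℓ/(ℓ+1)` comes from). This file proves, for `Re s > 1`: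

* `LSeries_coprime_eq_add`, `LSeries_dvd_coprime_eq`, `LSeries_coprime_mul_one_sub_cpow`: for a prime `ℓ ∤ M`,
  `L(𝟙_{⊥M}, s)·(1 − ℓ^{−s}) = L(𝟙_{⊥Mℓ}, s)` (split the sum by `ℓ ∣ N`, re-index `N = ℓN'`);
* `LSeries_coprimeMoebius_eq_one_sub_cpow_mul`: hence `L(𝟙_{⊥M}·μ, s) = (1 − ℓ^{−s})·L(𝟙_{⊥Mℓ}·μ, s)` (through the
  cancellation `L(𝟙_{⊥M}, s)·L(𝟙_{⊥M}·μ, s) = 1` of the analytic core);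
* `LSeries_coprimeMoebius_eq_prod_mul`: for a finite set `T` of primes not dividing `M`,
  `L(𝟙_{⊥M}·μ, s) = ∏_{ℓ∈T}(1 − ℓ^{−s}) · L(𝟙_{⊥(M·∏T)}·μ, s)`;
* `coprime_mul_iff_coprime_mul_prod_primeFactors_sdiff`: `g ⊥ 6mn ⟺ g ⊥ 6m·∏_{ℓ ∣ n, ℓ ∤ 6m} ℓ`, so the above applies with
  `M = 6m`, `T` = the primes of `n` outside `6m`: `LSeries_coprimeMoebius_six_mul_eq_prod_mul`.

Standard. [folklore]
-/

-- summit-side namespace `Summit.BirchSwinnertonDyer.BirchSwinnertonDyer.…` (single-conjunct summit, D-0017 layout)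
set_option linter.dupNamespace false

namespace Summit.BirchSwinnertonDyer.BirchSwinnertonDyer.Theorems.PrintCFram.FamilyMean

open Filter Topology Complex LSeries Finset
open scoped LSeries.notation ArithmeticFunction.Moebius

/-! ### §1. One prime -/

/-- `Σ_{N ⊥ M} N^{−s} = Σ_{N ⊥ Mℓ} N^{−s} + Σ_{ℓ ∣ N, N ⊥ M} N^{−s}` for a prime `ℓ ∤ M` (`Re s > 1`). [folklore] -/
theorem LSeries_coprime_eq_add {M ℓ : ℕ} (hℓ : ℓ.Prime) {s : ℂ} (hs : 1 < s.re) :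
    LSeries (fun N ↦ if N.Coprime M then (1 : ℂ) else 0) s =
      LSeries (fun N ↦ if N.Coprime (M * ℓ) then (1 : ℂ) else 0) s +
        LSeries (fun N ↦ if ℓ ∣ N ∧ N.Coprime M then (1 : ℂ) else 0) s := by
  have h1 : LSeriesSummable (fun N ↦ if N.Coprime (M * ℓ) then (1 : ℂ) else 0) s :=
    LSeriesSummable_of_bounded_of_one_lt_re (m := 1) (fun n _ ↦ by split_ifs <;> simp) hs
  have h2 : LSeriesSummable (fun N ↦ if ℓ ∣ N ∧ N.Coprime M then (1 : ℂ) else 0) s :=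
    LSeriesSummable_of_bounded_of_one_lt_re (m := 1) (fun n _ ↦ by split_ifs <;> simp) hs
  rw [← LSeries_add h1 h2]
  refine LSeries_congr (fun {N} _ ↦ ?_) s
  simp only [Pi.add_apply]
  by_cases hℓN : ℓ ∣ N
  · have hnc : ¬ N.Coprime (M * ℓ) := fun h ↦ by
      have hNℓ : N.Coprime ℓ := Nat.Coprime.coprime_dvd_right (dvd_mul_left ℓ M) h
      exact (Nat.Prime.coprime_iff_not_dvd hℓ).mp hNℓ.symm hℓN
    simp [hℓN, hnc]
  · have hiff : N.Coprime (M * ℓ) ↔ N.Coprime M := by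
      rw [Nat.coprime_mul_iff_right]
      exact ⟨fun h ↦ h.1, fun h ↦ ⟨h, ((Nat.Prime.coprime_iff_not_dvd hℓ).mpr hℓN).symm⟩⟩
    simp [hℓN, hiff]

/-- `Σ_{ℓ ∣ N, N ⊥ M} N^{−s} = ℓ^{−s} Σ_{N ⊥ M} N^{−s}` for a prime `ℓ ∤ M` (re-index `N = ℓN'`). [folklore] -/
theorem LSeries_dvd_coprime_eq {M ℓ : ℕ} (hℓ : ℓ.Prime) (hℓM : ¬ ℓ ∣ M) (s : ℂ) :
    LSeries (fun N ↦ if ℓ ∣ N ∧ N.Coprime M then (1 : ℂ) else 0) s =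
      (ℓ : ℂ) ^ (-s) * LSeries (fun N ↦ if N.Coprime M then (1 : ℂ) else 0) s := by
  set f : ℕ → ℂ := fun N ↦ if ℓ ∣ N ∧ N.Coprime M then (1 : ℂ) else 0 with hf
  have hinj : Function.Injective (fun k : ℕ ↦ ℓ * k) := mul_right_injective₀ hℓ.ne_zero
  have hsupp : Function.support (term f s) ⊆ Set.range (fun k : ℕ ↦ ℓ * k) := by
    intro N hN
    rw [Function.mem_support] at hN
    have hN0 : N ≠ 0 := by
      rintro rfl
      exact hN (term_zero f s)
    rw [term_of_ne_zero hN0] at hN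
    have hℓN : ℓ ∣ N := by
      by_contra h
      apply hN
      simp [hf, h]
    obtain ⟨k, rfl⟩ := hℓN
    exact ⟨k, rfl⟩
  unfold LSeries
  rw [← hinj.tsum_eq hsupp, ← tsum_mul_left]
  refine tsum_congr fun k ↦ ?_
  rcases eq_or_ne k 0 with rfl | hk
  · simp [term_zero]
  · rw [term_of_ne_zero (mul_ne_zero hℓ.ne_zero hk), term_of_ne_zero hk]
    have hcop : (ℓ * k).Coprime M ↔ k.Coprime M := by
      rw [Nat.coprime_mul_iff_left]
      exact ⟨fun h ↦ h.2, fun h ↦ ⟨(Nat.Prime.coprime_iff_not_dvd hℓ).mpr hℓM, h⟩⟩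
    simp only [hf, dvd_mul_right, true_and, hcop]
    rw [Nat.cast_mul, Complex.natCast_mul_natCast_cpow, cpow_neg]
    split_ifs
    · rw [one_div, one_div, mul_inv]
    · simp

/-- **`L(𝟙_{⊥M}, s)·(1 − ℓ^{−s}) = L(𝟙_{⊥Mℓ}, s)`** for a prime `ℓ ∤ M` (`Re s > 1`). [folklore] -/
theorem LSeries_coprime_mul_one_sub_cpow {M ℓ : ℕ} (hℓ : ℓ.Prime) (hℓM : ¬ ℓ ∣ M) {s : ℂ}
    (hs : 1 < s.re) :
    LSeries (fun N ↦ if N.Coprime M then (1 : ℂ) else 0) s * (1 - (ℓ : ℂ) ^ (-s)) =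
      LSeries (fun N ↦ if N.Coprime (M * ℓ) then (1 : ℂ) else 0) s := by
  have h := LSeries_coprime_eq_add (M := M) hℓ hs
  rw [LSeries_dvd_coprime_eq hℓ hℓM] at h
  linear_combination h

/-- **`L(𝟙_{⊥M}·μ, s) = (1 − ℓ^{−s}) · L(𝟙_{⊥Mℓ}·μ, s)`** for a prime `ℓ ∤ M` (`Re s > 1`): remove the Euler factor
`(1 − ℓ^{−s})` of `∏_{p ∤ M}(1 − p^{−s})`. [folklore] -/
theorem LSeries_coprimeMoebius_eq_one_sub_cpow_mul {M ℓ : ℕ} (hℓ : ℓ.Prime) (hℓM : ¬ ℓ ∣ M) {s : ℂ}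
    (hs : 1 < s.re) :
    LSeries (fun N ↦ if N.Coprime M then (μ N : ℂ) else 0) s =
      (1 - (ℓ : ℂ) ^ (-s)) * LSeries (fun N ↦ if N.Coprime (M * ℓ) then (μ N : ℂ) else 0) s := by
  have hA := LSeries_coprime_mul_LSeries_coprimeMoebius M hs
  have hB := LSeries_coprime_mul_LSeries_coprimeMoebius (M * ℓ) hs
  have hAB := LSeries_coprime_mul_one_sub_cpow hℓ hℓM hs
  set A := LSeries (fun N ↦ if N.Coprime M then (1 : ℂ) else 0) s
  set Aμ := LSeries (fun N ↦ if N.Coprime M then (μ N : ℂ) else 0) s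
  set B := LSeries (fun N ↦ if N.Coprime (M * ℓ) then (1 : ℂ) else 0) s
  set Bμ := LSeries (fun N ↦ if N.Coprime (M * ℓ) then (μ N : ℂ) else 0) s
  calc Aμ = Aμ * (B * Bμ) := by rw [hB, mul_one]
    _ = (A * Aμ) * (1 - (ℓ : ℂ) ^ (-s)) * Bμ := by rw [← hAB]; ring
    _ = (1 - (ℓ : ℂ) ^ (-s)) * Bμ := by rw [hA, one_mul]

/-! ### §2. Finitely many primes -/

/-- **`L(𝟙_{⊥M}·μ, s) = ∏_{ℓ∈T}(1 − ℓ^{−s}) · L(𝟙_{⊥(M·∏_{ℓ∈T} ℓ)}·μ, s)`** for a finite set `T` of primes not dividing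
`M` (`Re s > 1`). [folklore] -/
theorem LSeries_coprimeMoebius_eq_prod_mul {M : ℕ} (T : Finset ℕ) (hT : ∀ ℓ ∈ T, ℓ.Prime ∧ ¬ ℓ ∣ M)
    {s : ℂ} (hs : 1 < s.re) :
    LSeries (fun N ↦ if N.Coprime M then (μ N : ℂ) else 0) s =
      (∏ ℓ ∈ T, (1 - (ℓ : ℂ) ^ (-s))) *
        LSeries (fun N ↦ if N.Coprime (M * ∏ ℓ ∈ T, ℓ) then (μ N : ℂ) else 0) s := by
  induction T using Finset.induction_on with
  | empty => simp
  | insert a T haT ih =>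
    have hT' : ∀ ℓ ∈ T, ℓ.Prime ∧ ¬ ℓ ∣ M := fun ℓ hℓ ↦ hT ℓ (mem_insert_of_mem hℓ)
    obtain ⟨ha, haM⟩ := hT a (mem_insert_self a T)
    have haM' : ¬ a ∣ M * ∏ ℓ ∈ T, ℓ := by
      intro h
      rcases (Nat.Prime.dvd_mul ha).mp h with h | h
      · exact haM h
      · obtain ⟨ℓ, hℓT, hℓ⟩ := (Prime.dvd_finsetProd_iff ha.prime _).mp h
        have := (Nat.prime_dvd_prime_iff_eq ha (hT' ℓ hℓT).1).mp hℓ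
        exact haT (this ▸ hℓT)
    rw [ih hT', prod_insert haT, prod_insert haT, LSeries_coprimeMoebius_eq_one_sub_cpow_mul ha haM' hs,
      show M * (a * ∏ ℓ ∈ T, ℓ) = M * (∏ ℓ ∈ T, ℓ) * a by ring]
    ring

/-- `g ⊥ 6mn ⟺ g ⊥ 6m·∏_{ℓ ∣ n prime, ℓ ∤ 6m} ℓ` (`m, n ≥ 1`): coprimality only sees the prime support. [folklore] -/
theorem coprime_mul_iff_coprime_mul_prod_primeFactors_sdiff (m : ℕ) {n : ℕ} (hn : n ≠ 0) (g : ℕ) :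
    g.Coprime (6 * m * n) ↔ g.Coprime (6 * m * ∏ ℓ ∈ n.primeFactors \ (6 * m).primeFactors, ℓ) := by
  constructor
  · intro h
    refine Nat.Coprime.mul_right (Nat.Coprime.coprime_dvd_right (dvd_mul_right _ n) h) ?_
    exact Nat.coprime_prod_right_iff.mpr fun ℓ hℓ ↦ Nat.Coprime.coprime_dvd_right
      ((Nat.dvd_of_mem_primeFactors (Finset.mem_sdiff.mp hℓ).1).trans (dvd_mul_left n (6 * m))) h
  · intro h
    have h6m : g.Coprime (6 * m) := Nat.Coprime.coprime_dvd_right (dvd_mul_right _ _) h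
    have hT : ∀ ℓ ∈ n.primeFactors \ (6 * m).primeFactors, g.Coprime ℓ :=
      Nat.coprime_prod_right_iff.mp (Nat.Coprime.coprime_dvd_right (dvd_mul_left _ _) h)
    refine Nat.Coprime.mul_right h6m ?_
    by_contra hgn
    obtain ⟨p, hp, hpg, hpn⟩ := Nat.Prime.not_coprime_iff_dvd.mp hgn
    by_cases hp6m : p ∣ 6 * m
    · exact (Nat.Prime.coprime_iff_not_dvd hp).mp (Nat.Coprime.coprime_dvd_right hp6m h6m).symm hpg
    · have hpT : p ∈ n.primeFactors \ (6 * m).primeFactors := Finset.mem_sdiff.mpr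
        ⟨Nat.mem_primeFactors.mpr ⟨hp, hpn, hn⟩, fun h ↦ hp6m (Nat.dvd_of_mem_primeFactors h)⟩
      exact (Nat.Prime.coprime_iff_not_dvd hp).mp (hT p hpT).symm hpg

/-- **The `n`-dependence of the density constant as an Euler factor**: for `m, n ≥ 1` and `Re s > 1`,
`L(𝟙_{⊥6m}·μ, s) = ∏_{ℓ ∣ n, ℓ ∤ 6m} (1 − ℓ^{−s}) · L(𝟙_{⊥6mn}·μ, s)`. [folklore] -/
theorem LSeries_coprimeMoebius_six_mul_eq_prod_mul {m n : ℕ} (hm : m ≠ 0) (hn : n ≠ 0) {s : ℂ} (hs : 1 < s.re) :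
    LSeries (fun N ↦ if N.Coprime (6 * m) then (μ N : ℂ) else 0) s =
      (∏ ℓ ∈ n.primeFactors \ (6 * m).primeFactors, (1 - (ℓ : ℂ) ^ (-s))) *
        LSeries (fun N ↦ if N.Coprime (6 * m * n) then (μ N : ℂ) else 0) s := by
  have hT : ∀ ℓ ∈ n.primeFactors \ (6 * m).primeFactors, ℓ.Prime ∧ ¬ ℓ ∣ 6 * m := fun ℓ hℓ ↦
    ⟨Nat.prime_of_mem_primeFactors (Finset.mem_sdiff.mp hℓ).1, fun h ↦ (Finset.mem_sdiff.mp hℓ).2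
      (Nat.mem_primeFactors.mpr ⟨Nat.prime_of_mem_primeFactors (Finset.mem_sdiff.mp hℓ).1, h,
        mul_ne_zero (by norm_num) hm⟩)⟩
  rw [LSeries_coprimeMoebius_eq_prod_mul _ hT hs]
  congr 1
  refine LSeries_congr (fun {N} _ ↦ ?_) s
  simp only [coprime_mul_iff_coprime_mul_prod_primeFactors_sdiff m hn N]

end Summit.BirchSwinnertonDyer.BirchSwinnertonDyer.Theorems.PrintCFram.FamilyMean
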